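import Summits.RiemannHypothesis.RiemannHypothesis.Theorems.PfPersistenceAutocorrCeilingSharp
import HarnessLib

/-!
# PF-persistence cell — THE NEAR-LAG ONE-SIGNED ODD CEILING IS A MAXIMUM (sharpness of the ladder 186f1e2d346c)

Framing (page 1): mechanism/rigidity campaign; no RH claims.  Every `theorem` below is PROVED (kernel-checked,
RH-free, weight-free; §1–§4 are window-free facts about continuous real functions); nothing asserts a premiss for
`ζ` at any window and no NUMBER for `ζ` is asserted here.
THE QUESTION (RULING A376 (1) P1, recorded OPEN): the near-lag ladder (186f1e2d346c) bounds the odd autocorrelation of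
a profile ONE-SIGNED on the half window `H = [0, L/2]` by the chain constant `cos(π/(m+1))‖v‖²` on `L/(2m) ≤ y`, best
rung `m = ⌈L/(2y)⌉₊`; is that the ceiling of the METHOD only, or the true constrained supremum?  (The sign-free
universal ceiling of 9bb50f3e143f / 6ac0595cceaa is the larger constant `cos(π/(⌈L/y⌉₊+1))`.)
THIS FILE (continuous level, half-window length `T = L/2`): for every `0 < y < T` there is a continuous ODD `g`,
NONNEGATIVE on `[0, ∞)`, vanishing off `(−T, T)`, with `∫_{−T}^{T} g² > 0` and
`∫_{−T}^{T−y} g(x)g(x+y)dx = cos(π/(⌈T/y⌉₊+1))·∫_{−T}^{T} g²` (§3); hence `c` bounds the functional on the one-signed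
odd class iff `cos(π/(⌈T/y⌉₊+1)) ≤ c` (§4): the ladder constant IS the one-signed constrained supremum, attained.
MECHANISM: the straddle decomposition `A = S + 2B` (§1, every continuous odd `g`; §1 also proves the continuous
one-signed ceiling itself, one-signedness used on `[0, y]` only); a Perron bump train on `(0, T)` makes `2B` extremal
(6ac0595cceaa) and bumps of width `≤ y/2` kill the straddle piece `S = −∫_0^y g(s)g(y−s)ds` identically (§2: the
train and its reflection about `y/2` have disjoint supports).  §5: window dictionary `T = L/2` and the rung-free
Galerkin ceiling `A⁻_v(y) ≤ cos(π/(⌈L/(2y)⌉₊+1))‖v‖²`.  NOT claimed: the constrained supremum inside a FIXED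
degree-`N` Galerkin space (DATA elsewhere); anything about `ζ`.
-/

set_option linter.dupNamespace false
set_option linter.style.longLine false

noncomputable section

namespace Summit.RiemannHypothesis.RiemannHypothesis.Theorems.PfPersistence

open Real intervalIntegral MeasureTheory Finset

/-! ## §1 Continuous odd profiles: straddle decomposition and the one-signed ceiling -/

/-- PROVED (antisymmetry folds the left range onto `[0, T−y]`): for odd continuous `g`,
`∫_{−T}^{−y} g(x)g(x+y)dx = ∫_0^{T−y} g(t)g(t+y)dt` (substitute `x = −y − t`). [folklore] -/
theorem integral_odd_mul_shift_reflect {g : ℝ → ℝ} (hodd : ∀ x, g (-x) = -g x) (T y : ℝ) :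
    ∫ x in (-T)..(-y), g x * g (x + y) = ∫ t in (0:ℝ)..(T - y), g t * g (t + y) := by
  have h : (∫ x in (-T)..(-y), g (-y - x) * g (-y - x + y))
      = ∫ t in (-y - -y)..(-y - -T), g t * g (t + y) :=
    intervalIntegral.integral_comp_sub_left (fun t => g t * g (t + y)) (-y)
  have e1 : -y - -y = (0:ℝ) := by ring
  have e2 : -y - -T = T - y := by ring
  rw [e1, e2] at h
  rw [← h]
  refine intervalIntegral.integral_congr fun x _ => ?_
  show g x * g (x + y) = g (-y - x) * g (-y - x + y)
  rw [show -y - x + y = -x by ring, show -y - x = -(x + y) by ring, hodd, hodd]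
  ring

/-- **PROVED — THE STRADDLE DECOMPOSITION** (every continuous odd `g`, every `T`, `y`):
`∫_{−T}^{T−y} g g(·+y) = ∫_{−y}^{0} g g(·+y) + 2·∫_0^{T−y} g g(·+y)`. [folklore] -/
theorem integral_odd_mul_shift_eq_straddle_add {g : ℝ → ℝ} (hg : Continuous g) (hodd : ∀ x, g (-x) = -g x)
    (T y : ℝ) :
    ∫ x in (-T)..(T - y), g x * g (x + y)
      = (∫ x in (-y)..0, g x * g (x + y)) + 2 * ∫ t in (0:ℝ)..(T - y), g t * g (t + y) := by
  rw [← integral_mul_shift_add_adjacent hg y (-T) (-y) (T - y),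
    ← integral_mul_shift_add_adjacent hg y (-y) 0 (T - y), integral_odd_mul_shift_reflect hodd T y]
  ring

/-- PROVED: the straddle integrand is the NEGATIVE of a reflected product, `g(x)g(x+y) = −g(−x)g(y−(−x))`. [folklore] -/
theorem odd_mul_shift_eq_neg_reflect {g : ℝ → ℝ} (hodd : ∀ x, g (-x) = -g x) (x y : ℝ) :
    g x * g (x + y) = -(g (-x) * g (y - -x)) := by
  have hgx : g x = -g (-x) := by rw [hodd]; ring
  rw [hgx, show y - -x = x + y by ring]
  ring

/-- PROVED: the ENERGY of an odd continuous profile doubles the half-line energy, `∫_{−T}^{T} g² = 2∫_0^T g²`. [folklore] -/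
theorem integral_odd_sq_eq_two_mul {g : ℝ → ℝ} (hg : Continuous g) (hodd : ∀ x, g (-x) = -g x) (T : ℝ) :
    ∫ x in (-T)..T, g x ^ 2 = 2 * ∫ x in (0:ℝ)..T, g x ^ 2 := by
  have hleft : ∫ x in (-T)..0, g x ^ 2 = ∫ x in (0:ℝ)..T, g x ^ 2 := by
    have h : (∫ x in (-T)..0, (fun t => g t ^ 2) (0 - x)) = ∫ t in (0 - 0)..(0 - -T), g t ^ 2 :=
      intervalIntegral.integral_comp_sub_left (fun t => g t ^ 2) 0
    rw [show (0:ℝ) - 0 = 0 by ring, show (0:ℝ) - -T = T by ring] at h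
    rw [← h]
    refine intervalIntegral.integral_congr fun x _ => ?_
    show g x ^ 2 = g (0 - x) ^ 2
    rw [zero_sub, hodd]; ring
  rw [← integral_sq_add_adjacent hg (-T) 0 T, hleft]
  ring

/-- PROVED: the straddle piece is `≤ 0` for an odd profile one-signed on `[0, y]` (`0 ≤ y`): on `[−y, 0]` both `−x`
and `x + y` lie in `[0, y]`. One-signedness is used on `[0, y]` ONLY. [folklore] -/
theorem straddle_nonpos_of_odd_oneSigned {g : ℝ → ℝ} (hodd : ∀ x, g (-x) = -g x) {y : ℝ} (hy0 : 0 ≤ y)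
    (hsgn : (∀ x ∈ Set.Icc 0 y, 0 ≤ g x) ∨ (∀ x ∈ Set.Icc 0 y, g x ≤ 0)) :
    ∫ x in (-y)..0, g x * g (x + y) ≤ 0 := by
  have h : 0 ≤ ∫ x in (-y)..0, -(g x * g (x + y)) := by
    apply intervalIntegral.integral_nonneg (by linarith)
    intro x hx
    have hs : -x ∈ Set.Icc 0 y := ⟨by linarith [hx.2], by linarith [hx.1]⟩
    have ht : x + y ∈ Set.Icc 0 y := ⟨by linarith [hx.1], by linarith [hx.2]⟩
    rw [odd_mul_shift_eq_neg_reflect hodd x y, neg_neg, show y - -x = x + y by ring]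
    rcases hsgn with h | h
    · exact mul_nonneg (h _ hs) (h _ ht)
    · exact mul_nonneg_of_nonpos_of_nonpos (h _ hs) (h _ ht)
  rw [intervalIntegral.integral_neg] at h
  linarith

/-- **PROVED — THE CONTINUOUS NEAR-LAG ONE-SIGNED CEILING** (`0 < y < T`): an odd continuous profile one-signed on
`[0, y]` has `∫_{−T}^{T−y} g g(·+y) ≤ cos(π/(⌈T/y⌉₊+1))·∫_{−T}^{T} g²` (straddle `≤ 0`; the half-line piece by the
universal chain ceiling 9bb50f3e143f on `[0, T]`; energy doubling).  With `T = L/2` the constant is the best rung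
`cos(π/(⌈L/(2y)⌉₊+1))` of the ladder 186f1e2d346c. [cite: Mieghem2010, §6.4.1 eq. (6.10)] -/
theorem integral_odd_mul_shift_le_cos_ceil_of_oneSigned {g : ℝ → ℝ} (hg : Continuous g)
    (hodd : ∀ x, g (-x) = -g x) {T y : ℝ} (hy : 0 < y) (hyT : y < T)
    (hsgn : (∀ x ∈ Set.Icc 0 y, 0 ≤ g x) ∨ (∀ x ∈ Set.Icc 0 y, g x ≤ 0)) :
    ∫ x in (-T)..(T - y), g x * g (x + y)
      ≤ Real.cos (π / (((⌈T / y⌉₊ : ℕ) : ℝ) + 1)) * ∫ x in (-T)..T, g x ^ 2 := by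
  rw [integral_odd_mul_shift_eq_straddle_add hg hodd T y, integral_odd_sq_eq_two_mul hg hodd T]
  have h1 := straddle_nonpos_of_odd_oneSigned hodd hy.le hsgn
  have h2 := abs_integral_mul_shift_le_cos_ceil hg hy hyT
  have h3 := le_trans (le_abs_self _) h2
  linarith

/-! ## §2 Narrow bump trains: the reflected product vanishes -/

/-- PROVED: for a bump vanishing off `(0, w)` with `2w ≤ y`, every translate `β(· − jy)` and every reflected translate
`β(y − · − ky)` (`j, k ∈ ℕ`) have disjoint supports: `β(s − jy)·β(y − s − ky) = 0`. [folklore] -/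
theorem bump_mul_reflect_eq_zero {β : ℝ → ℝ} {w y : ℝ} (hβ : ∀ u, u ∉ Set.Ioo 0 w → β u = 0) (h2w : 2 * w ≤ y)
    (s : ℝ) (j k : ℕ) : β (s - j * y) * β (y - s - k * y) = 0 := by
  by_contra h
  have hj : β (s - j * y) ≠ 0 := fun h0 => h (by rw [h0, zero_mul])
  have hk : β (y - s - k * y) ≠ 0 := fun h0 => h (by rw [h0, mul_zero])
  have ⟨hj1, hj2⟩ : s - j * y ∈ Set.Ioo 0 w := by by_contra hc; exact hj (hβ _ hc)
  have ⟨hk1, hk2⟩ : y - s - k * y ∈ Set.Ioo 0 w := by by_contra hc; exact hk (hβ _ hc)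
  have hw : 0 < w := by linarith
  have hy : 0 ≤ y := by linarith
  have hjy : (0:ℝ) ≤ j * y := mul_nonneg (Nat.cast_nonneg j) hy
  have hky : (0:ℝ) ≤ k * y := mul_nonneg (Nat.cast_nonneg k) hy
  -- `k = 0` is forced (else `s < 0`), then `j = 0` (else `s ≥ y`), then `s < w ≤ y − w < s`
  rcases Nat.eq_zero_or_pos k with hk0 | hk0
  · subst hk0
    rcases Nat.eq_zero_or_pos j with hj0 | hj0
    · subst hj0
      simp only [Nat.cast_zero, zero_mul, sub_zero] at hj2 hk2
      linarith
    · have h1 : (1:ℝ) * y ≤ (j:ℝ) * y := mul_le_mul_of_nonneg_right (by exact_mod_cast hj0) hy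
      simp only [Nat.cast_zero, zero_mul, sub_zero] at hk1
      linarith
  · have h1 : (1:ℝ) * y ≤ (k:ℝ) * y := mul_le_mul_of_nonneg_right (by exact_mod_cast hk0) hy
    linarith

/-- PROVED: a NARROW bump train (`2w ≤ y`) and its reflection about `y/2` have disjoint supports:
`F(s)·F(y − s) = 0` for every `s`, `F = Σ_k x_k β(· − ky)`. [folklore] -/
theorem bumpTrain_mul_reflect_eq_zero {β : ℝ → ℝ} {w y : ℝ} (hβ : ∀ u, u ∉ Set.Ioo 0 w → β u = 0)
    (h2w : 2 * w ≤ y) (x : ℕ → ℝ) (M : ℕ) (s : ℝ) :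
    (∑ k ∈ range M, x k * β (s - k * y)) * (∑ j ∈ range M, x j * β (y - s - j * y)) = 0 := by
  rw [Finset.sum_mul_sum]
  refine Finset.sum_eq_zero fun k _ => Finset.sum_eq_zero fun j _ => ?_
  have h0 := bump_mul_reflect_eq_zero hβ h2w s k j
  calc x k * β (s - k * y) * (x j * β (y - s - j * y))
      = x k * x j * (β (s - k * y) * β (y - s - j * y)) := by ring
    _ = 0 := by rw [h0, mul_zero]

/-- **PROVED — THE NARROW BUMP-TRAIN INTEGRALS:** for `0 < y`, `(n+1)y < T` and ANY amplitudes there is a continuous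
`f` vanishing off `(0, T)` — a train of `n+2` disjoint hat bumps of width `≤ y/2` at mutual distance `y`, bump energy
`B > 0` — with `∫_0^T f² = (Σ_{k≤n+1} x_k²)·B`, `∫_0^{T-y} f f(·+y) = (Σ_{k≤n} x_k x_{k+1})·B`, nonnegative when the
amplitudes are, AND with IDENTICALLY VANISHING REFLECTED PRODUCT `f(s)f(y − s) = 0` (from the width). [folklore] -/
theorem exists_bumpTrain_integrals_narrow {y T : ℝ} (hy : 0 < y) (n : ℕ) (hT : ((n:ℝ) + 1) * y < T) (x : ℕ → ℝ) :
    ∃ f : ℝ → ℝ, Continuous f ∧ (∀ t, t ∉ Set.Ioo 0 T → f t = 0) ∧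
      ((∀ k, k ≤ n + 1 → 0 ≤ x k) → ∀ t, 0 ≤ f t) ∧ (∀ s, f s * f (y - s) = 0) ∧
      ∃ B : ℝ, 0 < B ∧
        (∫ t in (0:ℝ)..T, f t ^ 2 = (∑ k ∈ range (n + 2), x k ^ 2) * B) ∧
        (∫ t in (0:ℝ)..(T - y), f t * f (t + y) = (∑ k ∈ range (n + 1), x k * x (k + 1)) * B) := by
  -- bump width: half the lag, and the slack
  set w : ℝ := min (y / 2) (T - ((n:ℝ) + 1) * y) with hw_def
  have hw0 : 0 < w := lt_min (by linarith) (by linarith)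
  have h2w : 2 * w ≤ y := by have := min_le_left (y / 2) (T - ((n:ℝ) + 1) * y); linarith
  have hwy : w ≤ y := by linarith
  have hwT : ((n:ℝ) + 1) * y + w ≤ T := by
    have := min_le_right (y / 2) (T - ((n:ℝ) + 1) * y); linarith
  -- the bump and its energy
  obtain ⟨β, hβc, hβnn, hβ0, hβpos⟩ := exists_hat_bump w
  have hβK : HasCompactSupport (fun u => β u ^ 2) := by
    refine HasCompactSupport.intro (isCompact_Icc (a := (0:ℝ)) (b := w)) fun u hu => ?_
    have h0 : β u = 0 := hβ0 u (fun h => hu (Set.Ioo_subset_Icc_self h))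
    simp [h0]
  have hβi : Integrable (fun u => β u ^ 2) := (hβc.pow 2).integrable_of_hasCompactSupport hβK
  have hB : 0 < ∫ u, β u ^ 2 := by
    have hsupp : Function.support (fun u => β u ^ 2) ⊆ Set.Ioc 0 w := by
      intro u hu
      rw [Function.mem_support] at hu
      have hne : β u ≠ 0 := fun h => hu (by simp [h])
      have hmem : u ∈ Set.Ioo 0 w := by by_contra hc; exact hne (hβ0 u hc)
      exact ⟨hmem.1, hmem.2.le⟩
    rw [← intervalIntegral.integral_eq_integral_of_support_subset hsupp]
    exact intervalIntegral.intervalIntegral_pos_of_pos_on ((hβc.pow 2).intervalIntegrable _ _)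
      (fun u hu => pow_pos (hβpos u hu) 2) hw0
  -- the train
  refine ⟨fun t => ∑ k ∈ range (n + 2), x k * β (t - k * y), ?_, ?_, ?_, ?_, ∫ u, β u ^ 2, hB, ?_, ?_⟩
  · exact continuous_finsetSum _ fun k _ => continuous_const.mul (hβc.comp (continuous_id.sub continuous_const))
  · intro t ht
    refine Finset.sum_eq_zero fun k hk => ?_
    have hk' : (k:ℝ) ≤ (n:ℝ) + 1 := by
      have := Finset.mem_range.mp hk
      exact_mod_cast (show k ≤ n + 1 by omega)
    by_cases hmem : t - k * y ∈ Set.Ioo 0 w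
    · exfalso
      obtain ⟨h1, h2⟩ := hmem
      have hky : (0:ℝ) ≤ k * y := mul_nonneg (Nat.cast_nonneg k) hy.le
      have hkn : (k:ℝ) * y ≤ ((n:ℝ) + 1) * y := mul_le_mul_of_nonneg_right hk' hy.le
      exact ht ⟨by linarith, by linarith⟩
    · rw [hβ0 _ hmem, mul_zero]
  · intro hx t
    exact Finset.sum_nonneg fun k hk =>
      mul_nonneg (hx k (by have := Finset.mem_range.mp hk; omega)) (hβnn _)
  · intro s
    exact bumpTrain_mul_reflect_eq_zero hβ0 h2w x (n + 2) s
  · rw [intervalIntegral.integral_congr (fun t _ => bumpTrain_sq hβ0 hwy x (n + 2) t),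
      intervalIntegral.integral_eq_integral_of_support_subset
        (bumpTrain_support_subset hβ0 hy.le (fun k => x k ^ 2) (n + 2) (S := T) (by push_cast; linarith)),
      integral_bumpTrain_sq_sum hβi _ _ _]
  · show ∫ t in (0:ℝ)..(T - y), (∑ k ∈ range (n + 2), x k * β (t - k * y))
          * (∑ j ∈ range (n + 2), x j * β (t + y - j * y))
        = (∑ k ∈ range (n + 1), x k * x (k + 1)) * ∫ u, β u ^ 2
    rw [intervalIntegral.integral_congr (fun t _ => bumpTrain_mul_shift hβ0 hwy x n t),
      intervalIntegral.integral_eq_integral_of_support_subset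
        (bumpTrain_support_subset hβ0 hy.le (fun k => x k * x (k + 1)) (n + 1) (S := T - y)
          (by push_cast; linarith)),
      integral_bumpTrain_sq_sum hβi _ _ _]

/-! ## §3 The odd extension of a narrow Perron train attains the one-signed ceiling -/

/-- PROVED — THE ODD EXTENSION `g(x) = f(x) − f(−x)` of a continuous `f` vanishing off `(0, T)` (`0 ≤ y ≤ T`): continuous,
odd, `= f` on `[0, ∞)`, `= 0` off `(−T, T)`, energy `2∫_0^T f²`, same half-line correlation, straddle = `−∫` reflected products. [folklore] -/
theorem oddExtension_props {f : ℝ → ℝ} (hf : Continuous f) {T : ℝ} (hsupp : ∀ t, t ∉ Set.Ioo 0 T → f t = 0)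
    {y : ℝ} (hy : 0 ≤ y) (hyT : y ≤ T) :
    Continuous (fun x => f x - f (-x)) ∧ (∀ x, (f (-x) - f (-(-x))) = -(f x - f (-x))) ∧
      (∀ x, 0 ≤ x → f x - f (-x) = f x) ∧
      (∀ x, x ∉ Set.Ioo (-T) T → f x - f (-x) = 0) ∧
      (∫ x in (-T)..T, (f x - f (-x)) ^ 2 = 2 * ∫ x in (0:ℝ)..T, f x ^ 2) ∧
      (∫ t in (0:ℝ)..(T - y), (f t - f (-t)) * (f (t + y) - f (-(t + y)))
          = ∫ t in (0:ℝ)..(T - y), f t * f (t + y)) ∧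
      (∫ x in (-y)..0, (f x - f (-x)) * (f (x + y) - f (-(x + y)))
          = -∫ x in (-y)..0, f (-x) * f (y - -x)) := by
  have hneg : ∀ x, 0 ≤ x → f (-x) = 0 := fun x hx => hsupp _ (fun h => by linarith [h.1])
  have hpos : ∀ x, 0 ≤ x → f x - f (-x) = f x := fun x hx => by rw [hneg x hx, sub_zero]
  have hcont : Continuous (fun x => f x - f (-x)) := hf.sub (hf.comp continuous_neg)
  have hodd : ∀ x, (f (-x) - f (-(-x))) = -(f x - f (-x)) := fun x => by rw [neg_neg]; ring
  refine ⟨hcont, hodd, hpos, ?_, ?_, ?_, ?_⟩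
  · intro x hx
    by_cases hx0 : 0 ≤ x
    · rw [hpos x hx0]
      exact hsupp x (fun h => hx ⟨by linarith [h.1, h.2], h.2⟩)
    · push Not at hx0
      have h1 : f x = 0 := hsupp x (fun h => by linarith [h.1])
      have h2 : f (-x) = 0 := hsupp (-x) (fun h => hx ⟨by linarith [h.1, h.2], by linarith [h.1, h.2]⟩)
      rw [h1, h2, sub_zero]
  · have h := integral_odd_sq_eq_two_mul hcont hodd T
    rw [h]
    congr 1
    refine intervalIntegral.integral_congr fun x hx => ?_
    rw [Set.uIcc_of_le (by linarith : (0:ℝ) ≤ T)] at hx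
    show (f x - f (-x)) ^ 2 = f x ^ 2
    rw [hpos x hx.1]
  · refine intervalIntegral.integral_congr fun t ht => ?_
    rw [Set.uIcc_of_le (by linarith : (0:ℝ) ≤ T - y)] at ht
    show (f t - f (-t)) * (f (t + y) - f (-(t + y))) = f t * f (t + y)
    rw [hpos t ht.1, hpos (t + y) (by linarith [ht.1])]
  · rw [← intervalIntegral.integral_neg]
    refine intervalIntegral.integral_congr fun x hx => ?_
    rw [Set.uIcc_of_le (by linarith : -y ≤ (0:ℝ))] at hx
    have hx1 : f x = 0 := hsupp x (fun h => by linarith [h.1, hx.2])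
    have hx2 : f (-(x + y)) = 0 := hsupp _ (fun h => by linarith [h.1, hx.1])
    show (f x - f (-x)) * (f (x + y) - f (-(x + y))) = -(f (-x) * f (y - -x))
    rw [hx1, hx2, zero_sub, sub_zero, show y - -x = x + y by ring]
    ring

/-- **PROVED — ATTAINMENT IN THE ONE-SIGNED ODD CLASS (band form):** for `0 < y` and `(n+1)y < T` there is a
continuous ODD `g`, nonnegative on `[0, ∞)`, vanishing off `(−T, T)`, with `∫_{−T}^{T} g² > 0` and
`∫_{−T}^{T−y} g g(·+y) = cos(π/(n+3))·∫_{−T}^{T} g²` (odd extension of the narrow Perron train of `P_{n+2}`: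
straddle piece `0`, half-line piece extremal). [cite: Mieghem2010, §6.4.1 eq. (6.10)] -/
theorem exists_continuous_odd_oneSigned_integral_mul_shift_eq_cos {y T : ℝ} (hy : 0 < y) (n : ℕ)
    (hT : ((n:ℝ) + 1) * y < T) :
    ∃ g : ℝ → ℝ, Continuous g ∧ (∀ x, g (-x) = -g x) ∧ (∀ x, 0 ≤ x → 0 ≤ g x) ∧
      (∀ x, x ∉ Set.Ioo (-T) T → g x = 0) ∧
      0 < ∫ x in (-T)..T, g x ^ 2 ∧
      ∫ x in (-T)..(T - y), g x * g (x + y) = Real.cos (π / ((n:ℝ) + 3)) * ∫ x in (-T)..T, g x ^ 2 := by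
  obtain ⟨x, hxpos, hx⟩ := exists_perron_amplitudes n
  obtain ⟨f, hf, hsupp, hnn, hrefl, B, hB, hE, hC⟩ := exists_bumpTrain_integrals_narrow hy n hT x
  have hX : 0 < ∑ k ∈ range (n + 2), x k ^ 2 :=
    Finset.sum_pos (fun k hk => pow_pos (hxpos k (by have := Finset.mem_range.mp hk; omega)) 2) ⟨0, by simp⟩
  have hfnn : ∀ t, 0 ≤ f t := hnn fun k hk => (hxpos k hk).le
  have hyT : y ≤ T := by nlinarith [hT, hy, (Nat.cast_nonneg n : (0:ℝ) ≤ n)]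
  obtain ⟨hcont, hodd, hpos, hsupp', hEn, hCorr, hStr⟩ := oddExtension_props hf hsupp hy.le hyT
  refine ⟨fun x => f x - f (-x), hcont, hodd,
    fun x hx => by show 0 ≤ f x - f (-x); rw [hpos x hx]; exact hfnn x, hsupp', ?_, ?_⟩
  · rw [hEn, hE]; exact mul_pos two_pos (mul_pos hX hB)
  · rw [integral_odd_mul_shift_eq_straddle_add hcont hodd T y, hStr, hCorr, hEn, hC, hE, hx]
    have h0 : ∫ x in (-y)..0, f (-x) * f (y - -x) = 0 := by
      rw [intervalIntegral.integral_congr (g := fun _ => (0:ℝ)) (fun s _ => hrefl (-s))]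
      simp
    rw [h0]
    ring

/-- **PROVED — THE NEAR-LAG ONE-SIGNED ODD CEILING IS ATTAINED (sharp form):** for every `0 < y < T` there is a
continuous ODD `g`, nonnegative on `[0, ∞)`, vanishing off `(−T, T)`, with `∫_{−T}^{T} g² > 0` and
`∫_{−T}^{T−y} g(x)g(x+y)dx = cos(π/(⌈T/y⌉₊+1))·∫_{−T}^{T} g²` — EQUALITY in
`integral_odd_mul_shift_le_cos_ceil_of_oneSigned`: the chain constant of the best rung is the MAXIMUM of the
one-signed constrained problem (answers the question recorded OPEN in RULING A376 (1) P1, at the continuous level).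
[cite: Mieghem2010, §6.4.1 eq. (6.10)] -/
theorem exists_continuous_odd_oneSigned_integral_mul_shift_eq_cos_ceil {y T : ℝ} (hy : 0 < y) (hyT : y < T) :
    ∃ g : ℝ → ℝ, Continuous g ∧ (∀ x, g (-x) = -g x) ∧ (∀ x, 0 ≤ x → 0 ≤ g x) ∧
      (∀ x, x ∉ Set.Ioo (-T) T → g x = 0) ∧
      0 < ∫ x in (-T)..T, g x ^ 2 ∧
      ∫ x in (-T)..(T - y), g x * g (x + y)
        = Real.cos (π / (((⌈T / y⌉₊ : ℕ) : ℝ) + 1)) * ∫ x in (-T)..T, g x ^ 2 := by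
  obtain ⟨n, hT1, e3⟩ := exists_top_band hy hyT
  have h := exists_continuous_odd_oneSigned_integral_mul_shift_eq_cos hy n hT1
  rwa [e3] at h

/-! ## §4 Optimality: the exact constant of the one-signed odd class -/

/-- **PROVED — OPTIMALITY:** if `∫_{−T}^{T−y} g g(·+y) ≤ c·∫_{−T}^{T} g²` for every continuous odd `g` that is
nonnegative on `[0, ∞)`, then `cos(π/(⌈T/y⌉₊+1)) ≤ c` (`0 < y < T`): no argument using one-signedness on `H` can
lower the best-rung chain constant. [cite: Mieghem2010, §6.4.1 eq. (6.10)] -/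
theorem cos_ceil_le_of_forall_odd_oneSigned_integral_mul_shift_le {y T c : ℝ} (hy : 0 < y) (hyT : y < T)
    (h : ∀ g : ℝ → ℝ, Continuous g → (∀ x, g (-x) = -g x) → (∀ x, 0 ≤ x → 0 ≤ g x) →
      ∫ x in (-T)..(T - y), g x * g (x + y) ≤ c * ∫ x in (-T)..T, g x ^ 2) :
    Real.cos (π / (((⌈T / y⌉₊ : ℕ) : ℝ) + 1)) ≤ c := by
  obtain ⟨g, hg, hodd, hnn, -, hE, hcorr⟩ := exists_continuous_odd_oneSigned_integral_mul_shift_eq_cos_ceil hy hyT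
  have h1 := h g hg hodd hnn
  rw [hcorr] at h1
  exact le_of_mul_le_mul_right h1 hE

/-- **PROVED — THE EXACT CONSTANT OF THE ONE-SIGNED ODD CLASS:** for `0 < y < T`, `c` satisfies
`∫_{−T}^{T−y} g g(·+y) ≤ c·∫_{−T}^{T} g²` for every continuous odd `g` one-signed on `[0, T]` if and only if
`cos(π/(⌈T/y⌉₊+1)) ≤ c` (`if`: §1; `only if`: §3).  With `T = L/2`: the near-lag ladder constant
`c_m = cos(π/(m+1))`, `m = ⌈L/(2y)⌉₊`, IS the one-signed constrained supremum (continuous level), and it is attained.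
[cite: Mieghem2010, §6.4.1 eq. (6.10)] -/
theorem forall_odd_oneSigned_integral_mul_shift_le_iff {y T c : ℝ} (hy : 0 < y) (hyT : y < T) :
    (∀ g : ℝ → ℝ, Continuous g → (∀ x, g (-x) = -g x) →
        ((∀ x ∈ Set.Icc 0 T, 0 ≤ g x) ∨ (∀ x ∈ Set.Icc 0 T, g x ≤ 0)) →
        ∫ x in (-T)..(T - y), g x * g (x + y) ≤ c * ∫ x in (-T)..T, g x ^ 2)
      ↔ Real.cos (π / (((⌈T / y⌉₊ : ℕ) : ℝ) + 1)) ≤ c := by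
  constructor
  · intro h
    exact cos_ceil_le_of_forall_odd_oneSigned_integral_mul_shift_le hy hyT
      fun g hg hodd hnn => h g hg hodd (Or.inl fun x hx => hnn x hx.1)
  · intro hc g hg hodd hsgn
    have hsgn' : (∀ x ∈ Set.Icc 0 y, 0 ≤ g x) ∨ (∀ x ∈ Set.Icc 0 y, g x ≤ 0) := by
      rcases hsgn with h | h
      · exact Or.inl fun x hx => h x ⟨hx.1, le_trans hx.2 hyT.le⟩
      · exact Or.inr fun x hx => h x ⟨hx.1, le_trans hx.2 hyT.le⟩
    have h0 := integral_odd_mul_shift_le_cos_ceil_of_oneSigned hg hodd hy hyT hsgn'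
    have hsq : 0 ≤ ∫ x in (-T)..T, g x ^ 2 :=
      intervalIntegral.integral_nonneg (by linarith) fun t _ => sq_nonneg _
    exact le_trans h0 (mul_le_mul_of_nonneg_right hc hsq)

/-! ## §5 The window dictionary `T = L/2` and the rung-free Galerkin ceiling -/

/-- **PROVED — ATTAINMENT ON THE WINDOW `[−L/2, L/2]`** (`0 < y`, `2y < L`): a continuous ODD profile, nonnegative on
`H = [0, L/2]` (indeed on `[0, ∞)`), vanishing off the open window, with positive energy and
`∫_{−L/2}^{L/2−y} g g(·+y) = cos(π/(⌈L/(2y)⌉₊+1))·∫_{−L/2}^{L/2} g²`: the functional `A⁻ = oddAutocorr` extended to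
continuous odd profiles attains the best-rung constant of the ladder 186f1e2d346c inside the one-signed class.
[cite: Mieghem2010, §6.4.1 eq. (6.10)] -/
theorem exists_continuous_odd_oneSigned_window_shift_eq_cos_ceil {y L : ℝ} (hy : 0 < y) (hyL : 2 * y < L) :
    ∃ g : ℝ → ℝ, Continuous g ∧ (∀ x, g (-x) = -g x) ∧ (∀ x, 0 ≤ x → 0 ≤ g x) ∧
      (∀ x, x ∉ Set.Ioo (-(L / 2)) (L / 2) → g x = 0) ∧
      0 < ∫ x in (-(L / 2))..(L / 2), g x ^ 2 ∧
      ∫ x in (-(L / 2))..(L / 2 - y), g x * g (x + y)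
        = Real.cos (π / (((⌈L / (2 * y)⌉₊ : ℕ) : ℝ) + 1)) * ∫ x in (-(L / 2))..(L / 2), g x ^ 2 := by
  have h := exists_continuous_odd_oneSigned_integral_mul_shift_eq_cos_ceil (T := L / 2) hy (by linarith)
  rwa [div_div] at h

/-- **PROVED — THE EXACT WINDOW CONSTANT** (`0 < y`, `2y < L`): `c` bounds `∫_{−L/2}^{L/2−y} g g(·+y) ≤ c·∫ g²` on the
continuous odd profiles one-signed on `H = [0, L/2]` iff `cos(π/(⌈L/(2y)⌉₊+1)) ≤ c`. [cite: Mieghem2010, §6.4.1 eq. (6.10)] -/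
theorem forall_odd_oneSigned_window_shift_le_iff {y L c : ℝ} (hy : 0 < y) (hyL : 2 * y < L) :
    (∀ g : ℝ → ℝ, Continuous g → (∀ x, g (-x) = -g x) →
        ((∀ x ∈ Set.Icc 0 (L / 2), 0 ≤ g x) ∨ (∀ x ∈ Set.Icc 0 (L / 2), g x ≤ 0)) →
        ∫ x in (-(L / 2))..(L / 2 - y), g x * g (x + y) ≤ c * ∫ x in (-(L / 2))..(L / 2), g x ^ 2)
      ↔ Real.cos (π / (((⌈L / (2 * y)⌉₊ : ℕ) : ℝ) + 1)) ≤ c := by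
  have h := forall_odd_oneSigned_integral_mul_shift_le_iff (T := L / 2) (c := c) hy (by linarith)
  rwa [div_div] at h

/-- **PROVED — THE RUNG-FREE GALERKIN CEILING:** `θ⁻_v` one-signed on `H`, `0 < L`, `0 < y ≤ L` ⇒
`A⁻_v(y) ≤ cos(π/(⌈L/(2y)⌉₊+1))‖v‖²` — the ladder 186f1e2d346c at its best rung `m = ⌈L/(2y)⌉₊` (no rung hypothesis).
By §3–§4 this constant cannot be lowered by any argument valid for all continuous one-signed odd profiles.
[cite: Mieghem2010, §6.4.1 eq. (6.10)] -/
theorem oddAutocorr_le_cos_ceil_of_oneSignedOdd {L : ℝ} (hL : 0 < L) {N : ℕ} {v : Fin N → ℝ}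
    (hv : OneSignedOdd L v) {y : ℝ} (hy : 0 < y) (hyL : y ≤ L) :
    oddAutocorr L v y ≤ Real.cos (π / (((⌈L / (2 * y)⌉₊ : ℕ) : ℝ) + 1)) * (v ⬝ᵥ v) := by
  set m : ℕ := ⌈L / (2 * y)⌉₊ with hm
  have hx0 : 0 < L / (2 * y) := by positivity
  have hxm : L / (2 * y) ≤ (m:ℝ) := Nat.le_ceil _
  have hm1 : 1 ≤ m := by
    have : 0 < m := by exact_mod_cast (lt_of_lt_of_le hx0 hxm : (0:ℝ) < (m:ℝ))
    omega
  have hm0 : (0:ℝ) < m := by exact_mod_cast hm1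
  have hrung : L / (2 * (m:ℝ)) ≤ y := by
    rw [div_le_iff₀ (by positivity)]
    have h1 : L / (2 * y) * (2 * y) = L := div_mul_cancel₀ _ (by positivity)
    nlinarith [hxm, h1]
  exact oddAutocorr_le_cos_of_oneSignedOdd hL hv hm1 hrung hyL

end Summit.RiemannHypothesis.RiemannHypothesis.Theorems.PfPersistence

end
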